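import Literature.AlgebraicGeometry.Frobenioids.UnitsFunctor
import HarnessLib

/-!
# Frobenioids I, Proposition 2.2 (ii)(b): on a pre-step, `O^▷(φ_{D*})` is the bijection of
# Definition 1.3 (iii)(c) — proofs

Mochizuki, *The geometry of Frobenioids I: the general theory*, Kyushu J. Math. **62** (2008)
293–400, §2, Proposition 2.2 (ii), kurims text p. 45 ll. 20–28 [cite: MochizukiFrdI2008, Prop. 2.2 p.45]:
"There is a unique contravariant functor `D* → Mon` … such that for `φ : A → B` in `Arr(C^istr)`, with
image `φ_{D*}` in `D*`, the following properties are satisfied: (a) if `φ` is a [necessarily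
co-angular – cf. Proposition 1.4, (i)] linear morphism, then `O^▷(φ_{D*}) : O^▷(B) → O^▷(A)` is the
inclusion of Proposition 1.11, (iv); (b) if `φ` is a [necessarily co-angular] pre-step, then
`O^▷(φ_{D*}) : O^▷(B) → O^▷(A)` is the bijection of Definition 1.3, (iii), (c)."

PROOF-ONLY companion of `UnitsFunctor.lean` (statements, abc-iut-L1-t2, p406270). There the functor
is the datum `PreFrobenioid.UnitsFunctorData F`, whose field `res_base` renders (a) and (b) at once by
the intertwining relation `φ ≫ β = O^▷(Base φ)(β) ≫ φ` for LINEAR `φ` (pre-steps are linear). This file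
makes clause (b) kernel-explicit, as printed: for a [co-angular] pre-step `φ : A → B` of `C^istr`,
`O^▷(Base φ)` is a BIJECTION `O^▷(B) ⥲ O^▷(A)`, and it is the INVERSE of (every) bijection
`O^▷(A) ⥲ O^▷(B)`, `α ↦ β` with `β ∘ φ = φ ∘ α`, supplied by Def. 1.3 (iii)(c) (`IsFrobenioid.iii_c`).
Ingredients: functoriality of `O^▷(−)` (`res_id`, `res_comp`) — `Base(φ)` is an isomorphism for a
pre-step — and total epimorphicity of `C` (Def. 1.3, "pre-Frobenioid"). Sub-DAG row
`FrdI:Prop2.2(ii)/P22-L03b` of `HOME/staging/w5/w5-d162/SUBDAG-FrdI-Prop22.md` (abc-iut-w5-d162, W6 of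
plan/L1/DISCHARGE-L1.md §0). No new definitions; composition is diagrammatic.
-/

namespace Literature.AlgebraicGeometry.Frobenioids

open CategoryTheory Opposite

universe w v v' u u'

namespace PreFrobenioid

variable {D : Type u} [Category.{v} D] {Φ : Dᵒᵖ ⥤ CommMonCat.{w}}
  {C : Type u'} [Category.{v'} C] {F : C ⥤ ElemFrobenioid Φ}

namespace UnitsFunctorData

/-- Functoriality makes `O^▷(f)` a bijection whenever `f : A_D → B_D` is an isomorphism of `D`:
`O^▷(f⁻¹)` is a two-sided inverse (`res_comp`, `res_id`). [cite: MochizukiFrdI2008, Prop. 2.2(ii) p.45] -/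
theorem res_bijective_of_isIso (O : UnitsFunctorData F)
    {A B : (isotropicObjects F).FullSubcategory} (f : baseObj F A.obj ⟶ baseObj F B.obj) [IsIso f] :
    Function.Bijective (O.res f) := by
  have hl : Function.LeftInverse (O.res (A := B) (B := A) (inv f)) (O.res f) := fun β => by
    rw [← O.res_comp, IsIso.inv_hom_id, O.res_id]
  have hr : Function.RightInverse (O.res (A := B) (B := A) (inv f)) (O.res f) := fun α => by
    rw [← O.res_comp, IsIso.hom_inv_id, O.res_id]
  exact ⟨hl.injective, hr.surjective⟩

/-- **Prop. 2.2 (ii)(b), bijectivity**: for a pre-step `φ : A → B` of `C^istr`, `O^▷(φ_{D*}) = O^▷(Base φ)`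
is a bijection `O^▷(B) ⥲ O^▷(A)` (`Base(φ)` is an isomorphism, Def. 1.2 (iii)).
[cite: MochizukiFrdI2008, Prop. 2.2(ii) p.45] -/
theorem res_base_bijective_of_isPreStep (O : UnitsFunctorData F)
    {A B : (isotropicObjects F).FullSubcategory} (φ : A.obj ⟶ B.obj) (hφ : IsPreStep F φ) :
    Function.Bijective (O.res (Base F φ)) := by
  haveI : IsIso (Base F φ) := hφ.2
  exact O.res_bijective_of_isIso (Base F φ)

/-- **Prop. 2.2 (ii)(b), identification**: for a co-angular pre-step `φ : A → B` of `C^istr` and ANY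
bijection `e : O^▷(A) ⥲ O^▷(B)` as in Def. 1.3 (iii)(c) (`β = e(α)` iff `β ∘ φ = φ ∘ α`; supplied by
`IsFrobenioid.iii_c`, unique by `iii_c_base`), `O^▷(Base φ)` is the inverse of `e`: the intertwining
relation of `res_base` and that of `e` give `φ ≫ β = φ ≫ e(O^▷(Base φ)(β))`, and `φ` is an epimorphism
(`C` totally epimorphic). [cite: MochizukiFrdI2008, Prop. 2.2(ii) p.45] -/
theorem res_base_eq_symm_of_isCoAngularPreStep (hF : IsFrobenioid F) (O : UnitsFunctorData F)
    {A B : (isotropicObjects F).FullSubcategory} (φ : A.obj ⟶ B.obj) (hφ : IsCoAngularPreStep F φ)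
    (e : endSubmonoid F A.obj ≃* endSubmonoid F B.obj)
    (he : ∀ α : endSubmonoid F A.obj,
      φ ≫ (show B.obj ⟶ B.obj from (e α).1) = (show A.obj ⟶ A.obj from α.1) ≫ φ)
    (β : endSubmonoid F B.obj) : O.res (Base F φ) β = e.symm β := by
  haveI := hF.isPreFrobenioid.isTotallyEpimorphic.epi φ
  have h1 := O.res_base φ hφ.2.1 β
  have h2 := he (O.res (Base F φ) β)
  have h3 : β = e (O.res (Base F φ) β) := by
    apply Subtype.ext
    exact (cancel_epi φ).mp (h1.trans h2.symm)
  rw [MulEquiv.eq_symm_apply]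
  exact h3.symm

/-- **Prop. 2.2 (ii)(b)** as printed, for a pre-step `φ : A → B` of `C^istr` in a Frobenioid (every such
`φ` is co-angular: `A` isotropic forces every codomain out of `A` to be isotropic, Def. 1.3 (vii)(b), then
Prop. 1.4 (i)): there is a bijection `e : O^▷(A) ⥲ O^▷(B)` with `e(α) ∘ φ = φ ∘ α` — "the bijection of
Definition 1.3, (iii), (c)" — and `O^▷(φ_{D*}) = O^▷(Base φ) : O^▷(B) → O^▷(A)` is exactly its inverse.
[cite: MochizukiFrdI2008, Prop. 2.2(ii) p.45] -/
theorem res_base_isPreStep (hF : IsFrobenioid F) (O : UnitsFunctorData F)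
    {A B : (isotropicObjects F).FullSubcategory} (φ : A.obj ⟶ B.obj) (hφ : IsPreStep F φ) :
    ∃ e : endSubmonoid F A.obj ≃* endSubmonoid F B.obj,
      (∀ α : endSubmonoid F A.obj,
        φ ≫ (show B.obj ⟶ B.obj from (e α).1) = (show A.obj ⟶ A.obj from α.1) ≫ φ) ∧
      ∀ β : endSubmonoid F B.obj, O.res (Base F φ) β = e.symm β := by
  have hco : IsCoAngular F φ :=
    isCoAngular_of_isIsotropic_codomains F φ fun _ g => hF.vii_b g A.property
  obtain ⟨e, he⟩ := hF.iii_c φ ⟨hco, hφ⟩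
  exact ⟨e, he, fun β => O.res_base_eq_symm_of_isCoAngularPreStep hF φ ⟨hco, hφ⟩ e he β⟩

end UnitsFunctorData

end PreFrobenioid

end Literature.AlgebraicGeometry.Frobenioids
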